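import Summits.ResolutionOfSingularities.ResolutionOfSingularities.Theses.MaxContactCut
import Summits.ResolutionOfSingularities.ResolutionOfSingularities.Theorems.DeltaFaceCutClasses
import Summits.ResolutionOfSingularities.ResolutionOfSingularities.Theorems.DeltaFaceCutKernels
import Summits.ResolutionOfSingularities.ResolutionOfSingularities.Theorems.MaxContactCutTauLadder
import Summits.ResolutionOfSingularities.ResolutionOfSingularities.Theorems.MaxContactCutGenericPointCut
import Summits.ResolutionOfSingularities.ResolutionOfSingularities.Theorems.MaxContactCutFaceFormCut

/-!
# MaxContactCutDeltaFaceCut — the g11 node «DeltaFaceCut» wired to the route MaxContactCut BY NAME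
(decomp-res node N60, lens-2 g11 sha256 c250dd7a16ee789a; CRITIC-LEDGER line 96 CLEARED; phase 3 of 3)

Vocabulary, the ENGINE `DeltaPackageExit` with its paper proof, the port `PackagePort`, the graded statements:
`Theorems/DeltaFaceCutClasses`; the Theses-free pure-logic kernels: `Theorems/DeltaFaceCutKernels`.  Route asides
(MaxContactCut, `aside · rank 9`, refining `RungOne` 29273 and the g9/g10 lineage 31576/31577, 32106/32107):
`DFGenericRung` [DECIDED-MOD-PORT: engines `FaceFormExit` (tree) + `DeltaPackageExit` (NEW, prover target #19″) + ports
`PackagePort n` (M+) + `OrderOneContact` (S)], `DFSpecialRung` [THE LOCATED RESIDUAL of the rung after g11: data with a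
δ-SPECIAL core top point; EXACT sub-splits FAR / MID / CRIT and NONISO / ISO], `DFSpecialNonIso` [some δ-special top point
NOT isolated in the top locus — untouchable by point-centred engines; IDEA-NEEDED], `DFSpecialIso` [all δ-special top points
isolated; INSTRUMENTABLE, candidate ATTACKABLE].

Kernels (all by name, 0 sorry; the aside-level `Iff.rfl` unfoldings and re-keyings are the companion file
`MaxContactCutDeltaFaceCutAsides`, filed once the asides exist on the route): `RungOne ⟺ DFGenericRung ∧
DFSpecialRung` EXACTLY
(`rungOne_iff`, `rungOne_iff_asides`); necessity port-free (`deltaGenericRung_of_rungOne`, `deltaSpecialRung_of_rungOne`);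
the honesty kernel `deltaSpecialRung_iff_rungOne`; the node's deciding implications `closes`, `closes_of_engines`,
`closes_of_strata`, `closes_of_iso`, `closes_of_asides`; `DFSpecialRung ⟺ DFSpecialNonIso ∧ DFSpecialIso`
(`dfSpecialRung_iff_isoAsides`); the map edges to the located core 28544 (`closes_core`, through
`MaxContactCutTauLadder.closes`) and to 30461 (`closes_closedPointCore`); the §6 refinement edges to the g9 asides
31576–31579 (`ffGenericRung_of_deltaGenericRung`, `deltaSpecialRung_of_ffSpecialRung`, `ffSpecialRung_iff_deltaSpecialRung`,
`dSpecFar/Mid_of_ffSpecialDeep`, `dSpecCrit_of_ffSpecialCritical`, `closes_of_ffSpecialRung`) and to the g10 asides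
32106/32107 through `MaxContactCutVeryNearCut` is recorded in TREE.md (lineage 31576 ⊆ VNGenericRung ⊆ DFGenericRung by bed,
not by letter).  ROOT BY NAME is the route's `closes` (not restated).  WHY THIS IS NOVEL (critic row 75): the decided class
is cut by the δ-FACE of Hironaka's characteristic polyhedron at EVERY slope `δ = a/b > 1` and served by the m-PACKAGE of
blow-ups the face dictates — g9/g10 (`δ = 1 + 1/n`, one blow-up) are its first instance; the bed margin is positive.
(Sources: Hironaka1967 §1; CossartJannsenSaito2020 Def 6.34, Thm 10.2, Lemma 10.4, Cor 10.6; CossartPiltant2008 Prop 4.2;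
Moh1987.)
-/

namespace Summit.ResolutionOfSingularities.ResolutionOfSingularities.Theorems.MaxContactCutDeltaFaceCut

open CategoryTheory AlgebraicGeometry TopologicalSpace IsLocalRing
open Literature.AlgebraicGeometry.Resolution
open Summit.ResolutionOfSingularities.ResolutionOfSingularities.Theses
open Summit.ResolutionOfSingularities.ResolutionOfSingularities.Theorems
open Summit.ResolutionOfSingularities.ResolutionOfSingularities.Theorems.WeakOrderReduction
open DeltaFaceCutClasses DeltaFaceCutKernels

/-! ## §5 (route part)  The rung BY NAME -/

section Kernels

variable {n : ℕ}

/-- **EXACT AT THE RUNG**: `RungOne ⟺ DeltaGenericRung ∧ DeltaSpecialRung` (marking by marking). [folklore] -/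
theorem rungOne_iff : MaxContactCut.RungOne ↔ DeltaGenericRung ∧ DeltaSpecialRung := by
  constructor
  · intro h
    exact ⟨fun hE2 n hn => seqDGen_of_seqDimFour_one (h hE2 n hn),
      fun hE2 n hn => seqDSpec_of_seqDimFour_one (h hE2 n hn)⟩
  · rintro ⟨hG, hS⟩ hE2 n hn
    exact seqDimFour_one_iff.mpr ⟨hG hE2 n hn, hS hE2 n hn⟩

/-- NECESSITY by letter: the δ-generic half is implied by the rung. [folklore] -/
theorem deltaGenericRung_of_rungOne (h : MaxContactCut.RungOne) : DeltaGenericRung := (rungOne_iff.mp h).1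

/-- NECESSITY by letter: the located residual is implied by the rung. [folklore] -/
theorem deltaSpecialRung_of_rungOne (h : MaxContactCut.RungOne) : DeltaSpecialRung := (rungOne_iff.mp h).2

/-- HONESTY KERNEL: modulo the decided half, the located residual IS the rung. [folklore] -/
theorem deltaSpecialRung_iff_rungOne (hG : DeltaGenericRung) : DeltaSpecialRung ↔ MaxContactCut.RungOne :=
  ⟨fun hS => rungOne_iff.mpr ⟨hG, hS⟩, deltaSpecialRung_of_rungOne⟩

/-- **DECIDING IMPLICATION OF THE NODE**: `MaxContactCut.RungOne` (29273) BY NAME from the two halves. [folklore] -/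
theorem closes (hG : DeltaGenericRung) (hS : DeltaSpecialRung) : MaxContactCut.RungOne :=
  rungOne_iff.mpr ⟨hG, hS⟩

/-- `RungOne` BY NAME from the two ENGINES, the ports and the located residual. [folklore] -/
theorem closes_of_engines (hF : FaceFormCutClasses.FaceFormExit) (hD : DeltaPackageExit)
    (hP : ∀ n : ℕ, 2 ≤ n → PackagePort n) (h1 : FaceFormCutClasses.OrderOneContact) (hS : DeltaSpecialRung) :
    MaxContactCut.RungOne :=
  closes (deltaGenericRung_of_engines hF hD hP h1) hS

/-- `RungOne` BY NAME from the decided half and the three strata. [folklore] -/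
theorem closes_of_strata (hG : DeltaGenericRung) (hF : E 2 → ∀ n : ℕ, 1 ≤ n → SeqDSpecFar n)
    (hM : E 2 → ∀ n : ℕ, 1 ≤ n → SeqDSpecMid n) (hC : E 2 → ∀ n : ℕ, 1 ≤ n → SeqDSpecCrit n) :
    MaxContactCut.RungOne :=
  closes hG (deltaSpecialRung_iff_strata.mpr ⟨hF, hM, hC⟩)

/-- `RungOne` BY NAME from the decided half and the two isolation columns. [folklore] -/
theorem closes_of_iso (hG : DeltaGenericRung) (hN : E 2 → ∀ n : ℕ, 1 ≤ n → SeqDSpecNonIso n)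
    (hI : E 2 → ∀ n : ℕ, 1 ≤ n → SeqDSpecIso n) : MaxContactCut.RungOne :=
  closes hG (deltaSpecialRung_iff_iso.mpr ⟨hN, hI⟩)

/-! ### Map edges BY NAME to the tree's located residuals -/

/-- MAP EDGE to the located core `MaxContactCut.StepPICoreDimFour` (28544) BY NAME, through
`MaxContactCutTauLadder.closes`. [folklore] -/
theorem closes_core (h5 : MaxContactCutExhaustion.ContactOrderSequenceDimFour) (r4 : MaxContactCut.RungFour)
    (r3 : MaxContactCut.RungThree) (r2 : MaxContactCut.RungTwo) (hG : DeltaGenericRung) (hS : DeltaSpecialRung)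
    (hSS : MaxContactCut.SequenceToStepAll) : MaxContactCut.StepPICoreDimFour :=
  (MaxContactCutTauLadder.closes h5 r4 r3 r2 (closes hG hS) hSS).2.2.2.2

/-- MAP EDGE to g7's located residual `MaxContactCut.ClosedPointCoreAll` (30461) BY NAME. [folklore] -/
theorem closes_closedPointCore (hE2 : E 2) (h2 : MaxContactCut.RoundCodimTwoAll)
    (h3 : MaxContactCut.RoundCodimThreeAll) (hG : DeltaGenericRung) (hS : DeltaSpecialRung) :
    MaxContactCut.ClosedPointCoreAll :=
  (MaxContactCutGenericPointCut.rungOne_iff_core_of_rounds hE2 h2 h3).mp (closes hG hS)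

end Kernels

/-! ## §6  Refinement edges BY NAME to the g9 asides 31576–31579 -/

section Refinement

/-- A δ-special point is face-special (projection). [folklore] -/
theorem isFaceSpecialPt_of_isDeltaSpecialPt {k : Type} [Field k] {Y : Scheme.{0}} {g : Y ⟶ Spec (.of k)}
    {hY : Scheme.IsRegular Y} {I : Y.IdealSheafData} {n : ℕ} {y : Y} (h : IsDeltaSpecialPt g hY I n y) :
    FaceFormCutClasses.IsFaceSpecialPt g hY I n y :=
  h.1

/-- A far point is deep-faced (projection). [folklore] -/
theorem isDeepFacePt_of_isFarPt {Y : Scheme.{0}} {I : Y.IdealSheafData} {n : ℕ} {y : Y} (h : IsFarPt I n y) :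
    FaceFormCutClasses.IsDeepFacePt I n y := by
  obtain ⟨d, c, hc, hfr, hdeep, -⟩ := h
  exact ⟨d, c, hc, hfr, hdeep⟩

/-- **EDGE to 31576**: the δ-generic decided half implies the tree's g9 decided aside `FFGenericRung`. [folklore] -/
theorem ffGenericRung_of_deltaGenericRung (h : DeltaGenericRung) : MaxContactCut.FFGenericRung :=
  MaxContactCutFaceFormCut.ffGenericRung_iff.mpr fun hE2 n hn => seqGen_of_seqDGen (h hE2 n hn)

/-- **EDGE from 31577**: the tree's g9 located residual `FFSpecialRung` implies this node's located residual
(δ-special ⊆ face-special: the residual SHRINKS). [folklore] -/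
theorem deltaSpecialRung_of_ffSpecialRung (h : MaxContactCut.FFSpecialRung) : DeltaSpecialRung :=
  fun hE2 n hn => seqDSpec_of_seqSpec (MaxContactCutFaceFormCut.ffSpecialRung_iff.mp h hE2 n hn)

/-- HONESTY: modulo the decided half, the two located residuals (g9's 31577 and g11's) are EQUIVALENT — both are the
rung. [folklore] -/
theorem ffSpecialRung_iff_deltaSpecialRung (hG : DeltaGenericRung) :
    MaxContactCut.FFSpecialRung ↔ DeltaSpecialRung :=
  ⟨deltaSpecialRung_of_ffSpecialRung,
    fun hS => MaxContactCutFaceFormCut.specialRung_of_rungOne (closes hG hS)⟩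

/-- **EDGE from 31578 (i)**: the tree's DEEP stratum gives the FAR stratum (far ⇒ deep-faced, δ-special ⇒
face-special). [folklore] -/
theorem dSpecFar_of_ffSpecialDeep (h : MaxContactCut.FFSpecialDeep) : E 2 → ∀ n : ℕ, 1 ≤ n → SeqDSpecFar n := by
  intro hE2 n hn p hp k _ _ Y g h1 h2 h3 hY h4 I hord hex
  obtain ⟨y, hy, hs, hfar⟩ := hex
  exact MaxContactCutFaceFormCut.ffSpecialDeep_iff.mp h hE2 n hn p hp k Y g h1 h2 h3 hY h4 I hord
    ⟨y, hy, hs.1, isDeepFacePt_of_isFarPt hfar⟩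

/-- **EDGE from 31578 (ii)**: the tree's DEEP stratum gives the MID stratum (its third hypothesis is the deep stratum's).
[folklore] -/
theorem dSpecMid_of_ffSpecialDeep (h : MaxContactCut.FFSpecialDeep) : E 2 → ∀ n : ℕ, 1 ≤ n → SeqDSpecMid n := by
  intro hE2 n hn p hp k _ _ Y g h1 h2 h3 hY h4 I hord _ _ hdeep
  exact MaxContactCutFaceFormCut.ffSpecialDeep_iff.mp h hE2 n hn p hp k Y g h1 h2 h3 hY h4 I hord hdeep

/-- **EDGE from 31579**: the tree's CRITICAL stratum gives the CRIT stratum. [folklore] -/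
theorem dSpecCrit_of_ffSpecialCritical (h : MaxContactCut.FFSpecialCritical) :
    E 2 → ∀ n : ℕ, 1 ≤ n → SeqDSpecCrit n := by
  intro hE2 n hn p hp k _ _ Y g h1 h2 h3 hY h4 I hord hex hcrit
  obtain ⟨y, hy, hs⟩ := hex
  exact MaxContactCutFaceFormCut.ffSpecialCritical_iff.mp h hE2 n hn p hp k Y g h1 h2 h3 hY h4 I hord
    ⟨y, hy, hs.1⟩ hcrit

/-- The tree's two g9 strata give this node's located residual (through the three g11 strata). [folklore] -/
theorem deltaSpecialRung_of_ffStrata (hD : MaxContactCut.FFSpecialDeep) (hC : MaxContactCut.FFSpecialCritical) :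
    DeltaSpecialRung :=
  deltaSpecialRung_iff_strata.mpr
    ⟨dSpecFar_of_ffSpecialDeep hD, dSpecMid_of_ffSpecialDeep hD, dSpecCrit_of_ffSpecialCritical hC⟩

/-- `RungOne` BY NAME from the δ-generic decided half and the tree's g9 located residual 31577. [folklore] -/
theorem closes_of_ffSpecialRung (hG : DeltaGenericRung) (hS : MaxContactCut.FFSpecialRung) : MaxContactCut.RungOne :=
  closes hG (deltaSpecialRung_of_ffSpecialRung hS)

end Refinement
end Summit.ResolutionOfSingularities.ResolutionOfSingularities.Theorems.MaxContactCutDeltaFaceCut
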